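import Mathlib
import Summits.ResolutionOfSingularities.ResolutionOfSingularities.Theorems.WeightedInvariantLocalWeightedDropTOT2BranchChartInvariance
import Summits.ResolutionOfSingularities.ResolutionOfSingularities.Theorems.WeightedInvariantLocalWeightedDropTOT2ChartComapInjective
import Summits.ResolutionOfSingularities.ResolutionOfSingularities.Theorems.WeightedInvariantLocalWeightedDropNCBranchPrimesReading

/-!
# TOT2-LINE (P3): FORMAL COORDINATE CHANGES (shears, re-centrings) composed with a monomial chart — the `hB3` / `hinj` shapes of the B6 step
# theorems for the TRANSLATED POINT and the GRAPH MOVE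

Sub-problem `ResolutionOfSingularities`, ENGINE crux `stmt-ResolutionOfSingularities-8899` (`LocalWeightedDrop`), skeleton v35 (2e806da509994632),
registered stub `stub_conflictBudget` (P3); support for steps 5–6 of res-L1-w43-stub-2 g6's B6-PLAN (`L/res-L1-w43-stub-2/g6/B6-PLAN.md` §4:
«hB3c/hB4c/hinj for the COMPOSITE Φ = Φ₁ ∘ recentre ψ ∘ shear3 (C c)»; this hand res-L1-w43-stub-1 g7).  [OURS · L1 W4.3 · chain w43.  Engine
bookkeeping: nothing here is a statement of any manuscript; AI-produced, gate-checked, weaker than expert review.  «[OURS · L1 W4.3] replaces the role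
of nothing printed; NOT a statement of the manuscript.»]

A FORMAL COORDINATE CHANGE is `σ = subst θ` for a triple `θ` with zero constant terms and invertible linear part
(`IsUnit (FormalCoordChange.linMat θ).det`): it has a two-sided inverse (`NCBranchPrimes.exists_inverse_ringHom`), so it is a ring AUTOMORPHISM
of `R₃ = k⟦u₁,u₂,y⟧` (`exists_ringEquiv_coordChange`).  Instances in the tree: the shears `MonicDescent.shear3 h` (`u₂ ↦ u₂ + u₁h`) and the
re-centrings `NCPoly.recentre ψ` (`y ↦ y + ψ`).  Consequences (all unconditional in the prime `P′`):
* `branchVal_comap_coordChange` — `v_{σ⁻¹P′}(f) = v_{P′}(σ f)`; `ringKrullDim_quotient_comap_coordChange` — `dim R₃ ⧸ σ⁻¹P′ = dim R₃ ⧸ P′`;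
  `eq_of_comap_coordChange_eq` — `σ⁻¹P′ = σ⁻¹Q′ ⇒ P′ = Q′`;
* for a MONOMIAL CHART `Φ₁` (fixing the exceptional `X j`, multiplying the other variables by `1` or `X j`) composed with `σ`:
  `branchVal_comap_monomialChart_coordChange` (the `hB3` shape: `dim R₃ ⧸ σ⁻¹Φ₁⁻¹P′ = 1 ∧ ∀ f, v_{σ⁻¹Φ₁⁻¹P′}(f) = v_{P′}(Φ₁ (σ f))` above one-dimensional
  primes `P′ ∌ X j`) and `eq_of_comap_monomialChart_coordChange_eq` (the `hinj` shape), also through `Ideal.comap (Φ₁.comp σ)`.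
-/

set_option linter.dupNamespace false -- mandated namespace of this single-conjunct summit

noncomputable section

namespace Summit.ResolutionOfSingularities.ResolutionOfSingularities.Theorems

namespace TOT2Branch

open MvPowerSeries IsLocalRing
open Literature.AlgebraicGeometry.Resolution (FormalCoordChange.linMat)

variable {k : Type} [Field k]

/-! ## Formal coordinate changes are ring automorphisms -/

/-- A substitution with zero constant terms and invertible linear part is a ring automorphism of `k⟦u₁,u₂,y⟧` (as a `RingEquiv` whose forward map
is the substitution). -/
theorem exists_ringEquiv_coordChange {θ : Fin 3 → MvPowerSeries (Fin 3) k} (h0 : ∀ i, constantCoeff (θ i) = 0)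
    (hdet : IsUnit (FormalCoordChange.linMat θ).det) :
    ∃ e : MvPowerSeries (Fin 3) k ≃+* MvPowerSeries (Fin 3) k, ∀ x, e x = subst θ x := by
  obtain ⟨τ, h₁, h₂⟩ := NCBranchPrimes.exists_inverse_ringHom h0 hdet
  have hθ : HasSubst θ := hasSubst_of_constantCoeff_zero h0
  refine ⟨RingEquiv.ofBijective ((substAlgHom hθ : MvPowerSeries (Fin 3) k →ₐ[k] MvPowerSeries (Fin 3) k) : MvPowerSeries (Fin 3) k →+* MvPowerSeries (Fin 3) k)
    ⟨fun x y hxy => ?_, fun y => ⟨τ y, ?_⟩⟩, fun x => ?_⟩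
  · have h := congrArg τ hxy
    change τ ((substAlgHom hθ) x) = τ ((substAlgHom hθ) y) at h
    rwa [substAlgHom_apply, substAlgHom_apply, h₁, h₁] at h
  · change (substAlgHom hθ) (τ y) = y
    rw [substAlgHom_apply, h₂]
  · change (substAlgHom hθ) x = _
    rw [substAlgHom_apply]

/-- **Branch valuations along a formal coordinate change**: `v_{σ⁻¹P′}(f) = v_{P′}(σ f)` (unconditionally in `P′`). -/
theorem branchVal_comap_coordChange {θ : Fin 3 → MvPowerSeries (Fin 3) k} (h0 : ∀ i, constantCoeff (θ i) = 0)
    (hdet : IsUnit (FormalCoordChange.linMat θ).det) (P' : Ideal (MvPowerSeries (Fin 3) k)) (f : MvPowerSeries (Fin 3) k) :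
    branchVal (P'.comap (substAlgHom (hasSubst_of_constantCoeff_zero h0) : MvPowerSeries (Fin 3) k →ₐ[k] MvPowerSeries (Fin 3) k)) f =
      branchVal P' (subst θ f) := by
  obtain ⟨e, he⟩ := exists_ringEquiv_coordChange h0 hdet
  have hc : P'.comap (substAlgHom (hasSubst_of_constantCoeff_zero h0) : MvPowerSeries (Fin 3) k →ₐ[k] MvPowerSeries (Fin 3) k) =
      P'.comap (e : MvPowerSeries (Fin 3) k →+* MvPowerSeries (Fin 3) k) := by
    ext x
    rw [Ideal.mem_comap, Ideal.mem_comap, substAlgHom_apply, RingHom.coe_coe, he]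
  rw [hc, branchVal_comap_ringEquiv, ← he]

/-- **Dimension along a formal coordinate change**: `dim R₃ ⧸ σ⁻¹P′ = dim R₃ ⧸ P′`. -/
theorem ringKrullDim_quotient_comap_coordChange {θ : Fin 3 → MvPowerSeries (Fin 3) k} (h0 : ∀ i, constantCoeff (θ i) = 0)
    (hdet : IsUnit (FormalCoordChange.linMat θ).det) (P' : Ideal (MvPowerSeries (Fin 3) k)) :
    ringKrullDim (MvPowerSeries (Fin 3) k ⧸
        P'.comap (substAlgHom (hasSubst_of_constantCoeff_zero h0) : MvPowerSeries (Fin 3) k →ₐ[k] MvPowerSeries (Fin 3) k)) =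
      ringKrullDim (MvPowerSeries (Fin 3) k ⧸ P') := by
  obtain ⟨e, he⟩ := exists_ringEquiv_coordChange h0 hdet
  have hc : P'.comap (substAlgHom (hasSubst_of_constantCoeff_zero h0) : MvPowerSeries (Fin 3) k →ₐ[k] MvPowerSeries (Fin 3) k) =
      P'.comap (e : MvPowerSeries (Fin 3) k →+* MvPowerSeries (Fin 3) k) := by
    ext x
    rw [Ideal.mem_comap, Ideal.mem_comap, substAlgHom_apply, RingHom.coe_coe, he]
  rw [hc]
  exact ringKrullDim_eq_of_ringEquiv
    (Ideal.quotientEquiv _ P' e (Ideal.map_comap_of_surjective (e : MvPowerSeries (Fin 3) k →+* MvPowerSeries (Fin 3) k) e.surjective P').symm)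

/-- **Injectivity of the comap along a formal coordinate change** (on all ideals). -/
theorem eq_of_comap_coordChange_eq {θ : Fin 3 → MvPowerSeries (Fin 3) k} (h0 : ∀ i, constantCoeff (θ i) = 0)
    (hdet : IsUnit (FormalCoordChange.linMat θ).det) {P' Q' : Ideal (MvPowerSeries (Fin 3) k)}
    (h : P'.comap (substAlgHom (hasSubst_of_constantCoeff_zero h0) : MvPowerSeries (Fin 3) k →ₐ[k] MvPowerSeries (Fin 3) k) =
      Q'.comap (substAlgHom (hasSubst_of_constantCoeff_zero h0) : MvPowerSeries (Fin 3) k →ₐ[k] MvPowerSeries (Fin 3) k)) : P' = Q' := by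
  obtain ⟨e, he⟩ := exists_ringEquiv_coordChange h0 hdet
  have hsurj : Function.Surjective (substAlgHom (hasSubst_of_constantCoeff_zero h0) : MvPowerSeries (Fin 3) k →ₐ[k] MvPowerSeries (Fin 3) k) :=
    fun y => ⟨e.symm y, by rw [substAlgHom_apply, ← he, RingEquiv.apply_symm_apply]⟩
  exact Ideal.comap_injective_of_surjective _ hsurj h

/-! ## A monomial chart composed with a formal coordinate change: the `hB3` and `hinj` shapes -/

/-- **`hB3` FOR `Φ₁ ∘ σ`** (`Φ₁` a monomial chart with exceptional variable `X j`, `σ` a formal coordinate change): above every one-dimensional prime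
`P′ ∌ X j`, `dim R₃ ⧸ σ⁻¹Φ₁⁻¹P′ = 1` and `v_{σ⁻¹Φ₁⁻¹P′}(f) = v_{P′}(Φ₁ (σ f))`. -/
theorem branchVal_comap_monomialChart_coordChange (Φ₁ : MvPowerSeries (Fin 3) k →ₐ[k] MvPowerSeries (Fin 3) k) (j : Fin 3)
    (hfix : Φ₁ (X j) = X j) (hmon : ∀ i : Fin 3, Φ₁ (X i) = X i ∨ Φ₁ (X i) = X j * X i)
    {θ : Fin 3 → MvPowerSeries (Fin 3) k} (h0 : ∀ i, constantCoeff (θ i) = 0) (hdet : IsUnit (FormalCoordChange.linMat θ).det)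
    (P' : Ideal (MvPowerSeries (Fin 3) k)) [P'.IsPrime] (hdim' : ringKrullDim (MvPowerSeries (Fin 3) k ⧸ P') = 1)
    (hj : (X j : MvPowerSeries (Fin 3) k) ∉ P') :
    ringKrullDim (MvPowerSeries (Fin 3) k ⧸ (P'.comap Φ₁).comap
        (substAlgHom (hasSubst_of_constantCoeff_zero h0) : MvPowerSeries (Fin 3) k →ₐ[k] MvPowerSeries (Fin 3) k)) = 1 ∧
      ∀ f : MvPowerSeries (Fin 3) k,
        branchVal ((P'.comap Φ₁).comap (substAlgHom (hasSubst_of_constantCoeff_zero h0) : MvPowerSeries (Fin 3) k →ₐ[k] MvPowerSeries (Fin 3) k)) f =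
          branchVal P' (Φ₁ (subst θ f)) := by
  obtain ⟨h1, h2⟩ := branchVal_comap_monomialChart Φ₁ j hfix hmon P' hdim' hj
  refine ⟨?_, fun f => ?_⟩
  · rw [ringKrullDim_quotient_comap_coordChange h0 hdet, h1]
  · rw [branchVal_comap_coordChange h0 hdet, h2]

/-- The same through the composite algebra map `Φ₁.comp σ`. -/
theorem branchVal_comap_monomialChart_comp_coordChange (Φ₁ : MvPowerSeries (Fin 3) k →ₐ[k] MvPowerSeries (Fin 3) k) (j : Fin 3)
    (hfix : Φ₁ (X j) = X j) (hmon : ∀ i : Fin 3, Φ₁ (X i) = X i ∨ Φ₁ (X i) = X j * X i)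
    {θ : Fin 3 → MvPowerSeries (Fin 3) k} (h0 : ∀ i, constantCoeff (θ i) = 0) (hdet : IsUnit (FormalCoordChange.linMat θ).det)
    (P' : Ideal (MvPowerSeries (Fin 3) k)) [P'.IsPrime] (hdim' : ringKrullDim (MvPowerSeries (Fin 3) k ⧸ P') = 1)
    (hj : (X j : MvPowerSeries (Fin 3) k) ∉ P') :
    ringKrullDim (MvPowerSeries (Fin 3) k ⧸ P'.comap
        (Φ₁.comp (substAlgHom (hasSubst_of_constantCoeff_zero h0) : MvPowerSeries (Fin 3) k →ₐ[k] MvPowerSeries (Fin 3) k))) = 1 ∧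
      ∀ f : MvPowerSeries (Fin 3) k,
        branchVal (P'.comap (Φ₁.comp (substAlgHom (hasSubst_of_constantCoeff_zero h0) : MvPowerSeries (Fin 3) k →ₐ[k] MvPowerSeries (Fin 3) k))) f =
          branchVal P' (Φ₁ (subst θ f)) := by
  have hc : P'.comap (Φ₁.comp (substAlgHom (hasSubst_of_constantCoeff_zero h0) : MvPowerSeries (Fin 3) k →ₐ[k] MvPowerSeries (Fin 3) k)) =
      (P'.comap Φ₁).comap (substAlgHom (hasSubst_of_constantCoeff_zero h0) : MvPowerSeries (Fin 3) k →ₐ[k] MvPowerSeries (Fin 3) k) :=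
    Ideal.ext fun _ => Iff.rfl
  rw [hc]
  exact branchVal_comap_monomialChart_coordChange Φ₁ j hfix hmon h0 hdet P' hdim' hj

/-- **`hinj` FOR `Φ₁ ∘ σ`**: `σ⁻¹Φ₁⁻¹P′ = σ⁻¹Φ₁⁻¹Q′ ⇒ P′ = Q′` for one-dimensional primes `P′, Q′ ∌ X j`. -/
theorem eq_of_comap_monomialChart_coordChange_eq (Φ₁ : MvPowerSeries (Fin 3) k →ₐ[k] MvPowerSeries (Fin 3) k) (j : Fin 3)
    (hfix : Φ₁ (X j) = X j) (hmon : ∀ i : Fin 3, Φ₁ (X i) = X i ∨ Φ₁ (X i) = X j * X i)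
    {θ : Fin 3 → MvPowerSeries (Fin 3) k} (h0 : ∀ i, constantCoeff (θ i) = 0) (hdet : IsUnit (FormalCoordChange.linMat θ).det)
    {P' Q' : Ideal (MvPowerSeries (Fin 3) k)} (hP : P'.IsPrime) (hQ : Q'.IsPrime)
    (hdP : ringKrullDim (MvPowerSeries (Fin 3) k ⧸ P') = 1) (hdQ : ringKrullDim (MvPowerSeries (Fin 3) k ⧸ Q') = 1)
    (hXP : (X j : MvPowerSeries (Fin 3) k) ∉ P') (hXQ : (X j : MvPowerSeries (Fin 3) k) ∉ Q')
    (h : (P'.comap Φ₁).comap (substAlgHom (hasSubst_of_constantCoeff_zero h0) : MvPowerSeries (Fin 3) k →ₐ[k] MvPowerSeries (Fin 3) k) =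
      (Q'.comap Φ₁).comap (substAlgHom (hasSubst_of_constantCoeff_zero h0) : MvPowerSeries (Fin 3) k →ₐ[k] MvPowerSeries (Fin 3) k)) :
    P' = Q' :=
  eq_of_comap_eq_of_monomialChart Φ₁ j hfix hmon hP hQ hdP hdQ hXP hXQ (eq_of_comap_coordChange_eq h0 hdet h)

/-- The same through the composite algebra map `Φ₁.comp σ`. -/
theorem eq_of_comap_monomialChart_comp_coordChange_eq (Φ₁ : MvPowerSeries (Fin 3) k →ₐ[k] MvPowerSeries (Fin 3) k) (j : Fin 3)
    (hfix : Φ₁ (X j) = X j) (hmon : ∀ i : Fin 3, Φ₁ (X i) = X i ∨ Φ₁ (X i) = X j * X i)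
    {θ : Fin 3 → MvPowerSeries (Fin 3) k} (h0 : ∀ i, constantCoeff (θ i) = 0) (hdet : IsUnit (FormalCoordChange.linMat θ).det)
    {P' Q' : Ideal (MvPowerSeries (Fin 3) k)} (hP : P'.IsPrime) (hQ : Q'.IsPrime)
    (hdP : ringKrullDim (MvPowerSeries (Fin 3) k ⧸ P') = 1) (hdQ : ringKrullDim (MvPowerSeries (Fin 3) k ⧸ Q') = 1)
    (hXP : (X j : MvPowerSeries (Fin 3) k) ∉ P') (hXQ : (X j : MvPowerSeries (Fin 3) k) ∉ Q')
    (h : P'.comap (Φ₁.comp (substAlgHom (hasSubst_of_constantCoeff_zero h0) : MvPowerSeries (Fin 3) k →ₐ[k] MvPowerSeries (Fin 3) k)) =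
      Q'.comap (Φ₁.comp (substAlgHom (hasSubst_of_constantCoeff_zero h0) : MvPowerSeries (Fin 3) k →ₐ[k] MvPowerSeries (Fin 3) k))) :
    P' = Q' := by
  have hc : ∀ I : Ideal (MvPowerSeries (Fin 3) k),
      I.comap (Φ₁.comp (substAlgHom (hasSubst_of_constantCoeff_zero h0) : MvPowerSeries (Fin 3) k →ₐ[k] MvPowerSeries (Fin 3) k)) =
      (I.comap Φ₁).comap (substAlgHom (hasSubst_of_constantCoeff_zero h0) : MvPowerSeries (Fin 3) k →ₐ[k] MvPowerSeries (Fin 3) k) :=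
    fun I => Ideal.ext fun _ => Iff.rfl
  rw [hc, hc] at h
  exact eq_of_comap_monomialChart_coordChange_eq Φ₁ j hfix hmon h0 hdet hP hQ hdP hdQ hXP hXQ h

/-! ## The tree's coordinate changes: shears and re-centrings -/

/-- **The shear `(u₁, u₂ + u₁h, y)`** (`MonicDescent.shear3 h`): valuations, dimension, injectivity of the comap. -/
theorem branchVal_comap_shear3 (h : MvPowerSeries (Fin 2) k) (P' : Ideal (MvPowerSeries (Fin 3) k)) (f : MvPowerSeries (Fin 3) k) :
    branchVal (P'.comap (substAlgHom (hasSubst_of_constantCoeff_zero (MonicDescent.constantCoeff_shear3 h)) :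
      MvPowerSeries (Fin 3) k →ₐ[k] MvPowerSeries (Fin 3) k)) f = branchVal P' (subst (MonicDescent.shear3 h) f) :=
  branchVal_comap_coordChange (MonicDescent.constantCoeff_shear3 h) (by rw [MonicDescent.det_linMat_shear3]; exact isUnit_one) P' f

/-- Dimension along the shear. -/
theorem ringKrullDim_quotient_comap_shear3 (h : MvPowerSeries (Fin 2) k) (P' : Ideal (MvPowerSeries (Fin 3) k)) :
    ringKrullDim (MvPowerSeries (Fin 3) k ⧸ P'.comap (substAlgHom (hasSubst_of_constantCoeff_zero (MonicDescent.constantCoeff_shear3 h)) :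
      MvPowerSeries (Fin 3) k →ₐ[k] MvPowerSeries (Fin 3) k)) = ringKrullDim (MvPowerSeries (Fin 3) k ⧸ P') :=
  ringKrullDim_quotient_comap_coordChange (MonicDescent.constantCoeff_shear3 h) (by rw [MonicDescent.det_linMat_shear3]; exact isUnit_one) P'

/-- **The re-centring `y ↦ y + ψ(u)`** (`NCPoly.recentre ψ`): valuations, dimension. -/
theorem branchVal_comap_recentre {ψ : MvPowerSeries (Fin 2) k} (hψ : constantCoeff ψ = 0) (P' : Ideal (MvPowerSeries (Fin 3) k))
    (f : MvPowerSeries (Fin 3) k) :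
    branchVal (P'.comap (substAlgHom (hasSubst_of_constantCoeff_zero (NCPoly.constantCoeff_recentre hψ)) :
      MvPowerSeries (Fin 3) k →ₐ[k] MvPowerSeries (Fin 3) k)) f = branchVal P' (subst (NCPoly.recentre ψ) f) :=
  branchVal_comap_coordChange (NCPoly.constantCoeff_recentre hψ) (NCPoly.isUnit_det_linMat_recentre ψ) P' f

/-- Dimension along the re-centring. -/
theorem ringKrullDim_quotient_comap_recentre {ψ : MvPowerSeries (Fin 2) k} (hψ : constantCoeff ψ = 0) (P' : Ideal (MvPowerSeries (Fin 3) k)) :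
    ringKrullDim (MvPowerSeries (Fin 3) k ⧸ P'.comap (substAlgHom (hasSubst_of_constantCoeff_zero (NCPoly.constantCoeff_recentre hψ)) :
      MvPowerSeries (Fin 3) k →ₐ[k] MvPowerSeries (Fin 3) k)) = ringKrullDim (MvPowerSeries (Fin 3) k ⧸ P') :=
  ringKrullDim_quotient_comap_coordChange (NCPoly.constantCoeff_recentre hψ) (NCPoly.isUnit_det_linMat_recentre ψ) P'

end TOT2Branch

end Summit.ResolutionOfSingularities.ResolutionOfSingularities.Theorems

end
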